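import Mathlib.GroupTheory.Index
import Mathlib.GroupTheory.Coset.Basic
import Mathlib.LinearAlgebra.Quotient.Bilinear
import Mathlib.LinearAlgebra.Span.Basic
import Mathlib.LinearAlgebra.Dimension.Finrank
import Mathlib.LinearAlgebra.FiniteDimensional.Defs
import Literature.AlgebraicGeometry.HodgeTheory.SkewVanishingLattice

/-!
# Route LinearSystemTorelli — crux `LocalTubeSpan`: Lemma 11 frames pushed through the radical quotient ("QuotientTransfer")

Helper file (`--supports stmt-HodgeConjecture-2490`, line `Sketch`, cycle 6, stub
`stub_quotientTransfer`).  Cycle 6 of the line derives Schnell's Lemma 11 (C. Schnell, *Primitive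
cohomology and the tube mapping*, Math. Z. 268 (2010) §7 Lemma 11, after Janssen: a skew-symmetric
vanishing lattice `Δ` in a space of dimension `r` contains `r` linearly independent elements whose
transvections `T_δ(x) = x - B(x, δ)δ` generate a finite-index subgroup of the monodromy group
`Γ_Δ`) for lattices with a DEGENERATE alternating form `B` from the NONDEGENERATE case.  This file
is the first half, the transfer DOWN to the nondegenerate quotient and back UP in coset form:

* the radical `R = ker B = {x | B(x, ·) = 0}` of an alternating form is two-sided, so `B` descends
  to a nondegenerate alternating form `B̄` on `V / R` with `B̄([x], [y]) = B(x, y)` (Mathlib's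
  `LinearMap.liftQ₂`; kept as an existence statement `localTubeSpan_exists_quotForm`, no
  definition);
* transvections commute with the projection, `T_{[δ]}[x] = [T_δ x]`
  (`localTubeSpan_skewTransvection_push`), whence every `g ∈ Γ_Δ` has an image `w ∈ Γ_{[Δ]}` with
  `w [x] = [g x]` and every `w ∈ Γ_{[Δ]}` has such a lift `g ∈ Γ_Δ` — proved for an arbitrary set
  `Δ` by one closure induction over a multiplicative relation
  (`localTubeSpan_closure_exists_related`, `…_transvectionGroup_push`, `…_transvectionGroup_lift`),
  so that it serves the lattice `Δ` and the frame `{δ₁, …, δ_r}` alike;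
* hence the image `[Δ] ⊆ V / R` of a skew vanishing lattice is a skew vanishing lattice for `B̄`
  (`localTubeSpan_isSkewVanishingLattice_push`: finitely generated, integral, spanning, one orbit,
  a pair with `⟨δ₁, δ₂⟩ = 1`);
* `localTubeSpan_quotientTransfer`: Lemma 11 for NONDEGENERATE lattices, applied to
  `(V / R, B̄, [Δ])`, gives `r = dim V / R` elements `δ₁, …, δ_r ∈ Δ` linearly independent modulo
  `R` and finitely many `c ∈ Γ_Δ` (lifts of coset representatives of the frame group downstairs,
  `localTubeSpan_exists_finset_coset_reps`) such that every `g ∈ Γ_Δ` agrees modulo `R` with some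
  `c · h`, `h ∈ Γ_{{δ₁, …, δ_r}}` — the finite index downstairs read through `Γ_Δ → Γ_{[Δ]}`
  without any quotient group in the interface.

The second half (the frame LIFT from these data to Lemma 11 for `(V, B, Δ)` itself) is the lead's
stub `stub_frameLift`.  Elementary; the nondegenerate Lemma 11 enters only as the explicit
hypothesis `hL11nd` of the last theorem (no named fact is used).
-/

-- `Summit.HodgeConjecture.HodgeConjecture.Theorems` is the mandated namespace (single-conjunct summit:
-- Sub = Summit), which `linter.dupNamespace` flags on every declaration; the lakefile turns the
-- linter off tree-wide (weak option), restated here so stand-alone elaboration is warning-free too.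
set_option linter.dupNamespace false

noncomputable section

open Literature.AlgebraicGeometry.HodgeTheory

namespace Summit.HodgeConjecture.HodgeConjecture.Theorems

/-! ### Closure induction over a multiplicative relation; coset representatives -/

section GroupTheory

/-- If a relation `Rel` between two groups contains `(1, 1)` and is closed under products and
inverses, and every generator `u ∈ s` is related to some element of a subgroup `T`, then every
element of the group generated by `s` is related to some element of `T`. [folklore] -/
theorem localTubeSpan_closure_exists_related {G₁ G₂ : Type*} [Group G₁] [Group G₂]
    (Rel : G₁ → G₂ → Prop) (h1 : Rel 1 1)
    (hmul : ∀ a b a' b', Rel a b → Rel a' b' → Rel (a * a') (b * b'))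
    (hinv : ∀ a b, Rel a b → Rel a⁻¹ b⁻¹) (s : Set G₁) (T : Subgroup G₂)
    (hs : ∀ u ∈ s, ∃ w ∈ T, Rel u w) {g : G₁} (hg : g ∈ Subgroup.closure s) :
    ∃ w ∈ T, Rel g w := by
  induction hg using Subgroup.closure_induction with
  | mem u hu => exact hs u hu
  | one => exact ⟨1, T.one_mem, h1⟩
  | mul a a' _ _ ih ih' =>
      obtain ⟨b, hb, hab⟩ := ih
      obtain ⟨b', hb', hab'⟩ := ih'
      exact ⟨b * b', T.mul_mem hb hb', hmul a b a' b' hab hab'⟩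
  | inv a _ ih =>
      obtain ⟨b, hb, hab⟩ := ih
      exact ⟨b⁻¹, T.inv_mem hb, hinv a b hab⟩

/-- **Coset representatives.**  If `F ∩ Γ` has finite index in `Γ` (subgroups of a group `M`), there
is a finite set `S ⊆ Γ` of left-coset representatives: every `w ∈ Γ` is `s · f` with `s ∈ S`,
`f ∈ F`. [folklore] -/
theorem localTubeSpan_exists_finset_coset_reps {M : Type*} [Group M] (Γ F : Subgroup M)
    (hfi : (F.subgroupOf Γ).FiniteIndex) :
    ∃ S : Finset M, (∀ s ∈ S, s ∈ Γ) ∧ ∀ w ∈ Γ, ∃ s ∈ S, s⁻¹ * w ∈ F := by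
  classical
  haveI := hfi
  haveI : Fintype (Γ ⧸ F.subgroupOf Γ) := Fintype.ofFinite _
  refine ⟨Finset.univ.image fun q : Γ ⧸ F.subgroupOf Γ => ((Quotient.out q : Γ) : M), ?_, ?_⟩
  · intro s hs
    obtain ⟨q, -, rfl⟩ := Finset.mem_image.1 hs
    exact (Quotient.out q).2
  · intro w hw
    refine ⟨((Quotient.out (QuotientGroup.mk (⟨w, hw⟩ : Γ) : Γ ⧸ F.subgroupOf Γ) : Γ) : M),
      Finset.mem_image_of_mem _ (Finset.mem_univ _), ?_⟩
    have hmem : ((Quotient.out (QuotientGroup.mk (⟨w, hw⟩ : Γ) : Γ ⧸ F.subgroupOf Γ))⁻¹ *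
        ⟨w, hw⟩ : Γ) ∈ F.subgroupOf Γ :=
      QuotientGroup.eq.1 (QuotientGroup.out_eq' _)
    exact Subgroup.mem_subgroupOf.1 hmem

end GroupTheory

/-! ### Pushing transvections and lattices along a form-preserving linear map -/

section Push

variable {V W : Type*} [AddCommGroup V] [Module ℚ V] [AddCommGroup W] [Module ℚ W]
  (B : LinearMap.BilinForm ℚ V) (Bq : LinearMap.BilinForm ℚ W) (π : V →ₗ[ℚ] W)

/-- Transvections commute with a form-preserving linear map: `T_{π δ} (π x) = π (T_δ x)`.
[folklore] -/
theorem localTubeSpan_skewTransvection_push (hπ : ∀ x y, Bq (π x) (π y) = B x y) (δ x : V) :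
    skewTransvection Bq (π δ) (π x) = π (skewTransvection B δ x) := by
  rw [skewTransvection_apply, skewTransvection_apply, hπ, map_sub, map_smul]

/-- If `w ∘ π = π ∘ g` for invertible `g`, `w`, then `w⁻¹ ∘ π = π ∘ g⁻¹`. [folklore] -/
theorem localTubeSpan_push_inv {g : (V →ₗ[ℚ] V)ˣ} {w : (W →ₗ[ℚ] W)ˣ}
    (h : ∀ x, (w : W →ₗ[ℚ] W) (π x) = π ((g : V →ₗ[ℚ] V) x)) (x : V) :
    ((w⁻¹ : (W →ₗ[ℚ] W)ˣ) : W →ₗ[ℚ] W) (π x) = π (((g⁻¹ : (V →ₗ[ℚ] V)ˣ) : V →ₗ[ℚ] V) x) := by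
  have h1 : (g : V →ₗ[ℚ] V) (((g⁻¹ : (V →ₗ[ℚ] V)ˣ) : V →ₗ[ℚ] V) x) = x := by
    rw [← Module.End.mul_apply, Units.mul_inv, Module.End.one_apply]
  have h2 := h (((g⁻¹ : (V →ₗ[ℚ] V)ˣ) : V →ₗ[ℚ] V) x)
  rw [h1] at h2
  rw [← h2, ← Module.End.mul_apply, Units.inv_mul, Module.End.one_apply]

/-- **Every element of `Γ_Δ` has an image**: along a form-preserving linear map `π` (alternating
`B`), for every `g ∈ Γ_Δ` there is `w ∈ Γ_{π Δ}` with `w (π x) = π (g x)` (closure induction: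
the generator `T_δ` maps to `T_{π δ}`). [folklore] -/
theorem localTubeSpan_transvectionGroup_push (hB : B.IsAlt) (hπ : ∀ x y, Bq (π x) (π y) = B x y)
    {Δ : Set V} {g : (V →ₗ[ℚ] V)ˣ} (hg : g ∈ transvectionGroup B Δ) :
    ∃ w ∈ transvectionGroup Bq (π '' Δ), ∀ x, (w : W →ₗ[ℚ] W) (π x) = π ((g : V →ₗ[ℚ] V) x) := by
  unfold transvectionGroup at hg
  refine localTubeSpan_closure_exists_related
    (fun (a : (V →ₗ[ℚ] V)ˣ) (b : (W →ₗ[ℚ] W)ˣ) =>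
      ∀ x, (b : W →ₗ[ℚ] W) (π x) = π ((a : V →ₗ[ℚ] V) x))
    (fun _ => rfl) (fun a b a' b' hab hab' x => ?_)
    (fun a b hab => localTubeSpan_push_inv π hab) _ _ ?_ hg
  · rw [Units.val_mul, Units.val_mul, Module.End.mul_apply, Module.End.mul_apply, hab', hab]
  · rintro u ⟨δ, hδ, hu⟩
    have h0 : Bq (π δ) (π δ) = 0 := by rw [hπ]; exact hB δ
    refine ⟨LinearMap.GeneralLinearGroup.ofLinearEquiv (skewTransvectionEquiv Bq h0),
      unit_skewTransvection_mem_transvectionGroup Bq (Set.mem_image_of_mem π hδ) h0, fun x => ?_⟩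
    rw [hu]
    exact localTubeSpan_skewTransvection_push B Bq π hπ δ x

/-- **Every element of `Γ_{π Δ}` lifts**: along a form-preserving linear map `π` (alternating `B`),
for every `w ∈ Γ_{π Δ}` there is `g ∈ Γ_Δ` with `w (π x) = π (g x)` (closure induction: a
generator is `T_{π δ}`, `δ ∈ Δ`, and lifts to `T_δ`). [folklore] -/
theorem localTubeSpan_transvectionGroup_lift (hB : B.IsAlt) (hπ : ∀ x y, Bq (π x) (π y) = B x y)
    {Δ : Set V} {w : (W →ₗ[ℚ] W)ˣ} (hw : w ∈ transvectionGroup Bq (π '' Δ)) :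
    ∃ g ∈ transvectionGroup B Δ, ∀ x, (w : W →ₗ[ℚ] W) (π x) = π ((g : V →ₗ[ℚ] V) x) := by
  unfold transvectionGroup at hw
  refine localTubeSpan_closure_exists_related
    (fun (b : (W →ₗ[ℚ] W)ˣ) (a : (V →ₗ[ℚ] V)ˣ) =>
      ∀ x, (b : W →ₗ[ℚ] W) (π x) = π ((a : V →ₗ[ℚ] V) x))
    (fun _ => rfl) (fun b a b' a' hab hab' x => ?_)
    (fun b a hab => localTubeSpan_push_inv π hab) _ _ ?_ hw
  · rw [Units.val_mul, Units.val_mul, Module.End.mul_apply, Module.End.mul_apply, hab', hab]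
  · rintro u ⟨_, ⟨δ, hδ, rfl⟩, hu⟩
    refine ⟨LinearMap.GeneralLinearGroup.ofLinearEquiv (skewTransvectionEquiv B (hB δ)),
      unit_skewTransvection_mem_transvectionGroup B hδ (hB δ), fun x => ?_⟩
    rw [hu]
    exact localTubeSpan_skewTransvection_push B Bq π hπ δ x

/-- **The image of a skew vanishing lattice is a skew vanishing lattice**: along a SURJECTIVE
form-preserving linear map `π` (alternating `B`), `π Δ` is again finitely generated over `ℤ`,
integral, spanning, a single orbit of its own monodromy group `Γ_{π Δ}` (images and lifts of
monodromies), and contains a pair with `⟨π δ₁, π δ₂⟩ = 1`. [folklore] -/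
theorem localTubeSpan_isSkewVanishingLattice_push (hB : B.IsAlt)
    (hπ : ∀ x y, Bq (π x) (π y) = B x y) (hπs : Function.Surjective π) {Δ : Set V}
    (hΔ : IsSkewVanishingLattice B Δ) : IsSkewVanishingLattice Bq (π '' Δ) := by
  refine ⟨?_, ?_, ?_, ?_, ?_, ?_⟩
  · -- `ℤ·(π Δ)` is the image of `ℤ·Δ`
    have h := hΔ.fg.map (π.restrictScalars ℤ)
    rwa [Submodule.map_span, LinearMap.coe_restrictScalars] at h
  · rintro _ ⟨δ, hδ, rfl⟩ _ ⟨δ', hδ', rfl⟩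
    obtain ⟨n, hn⟩ := hΔ.integral δ hδ δ' hδ'
    exact ⟨n, by rw [hπ, hn]⟩
  · rw [← Submodule.map_span π Δ, hΔ.span_eq_top, Submodule.map_top, LinearMap.range_eq_top]
    exact hπs
  · rintro w hw _ ⟨δ, hδ, rfl⟩
    obtain ⟨g, hg, hgw⟩ := localTubeSpan_transvectionGroup_lift B Bq π hB hπ hw
    exact ⟨_, hΔ.stable g hg δ hδ, (hgw δ).symm⟩
  · rintro _ ⟨δ, hδ, rfl⟩ _ ⟨δ', hδ', rfl⟩
    obtain ⟨g, hg, hgδ⟩ := hΔ.transitive δ hδ δ' hδ'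
    obtain ⟨w, hw, hwg⟩ := localTubeSpan_transvectionGroup_push B Bq π hB hπ hg
    exact ⟨w, hw, by rw [hwg, hgδ]⟩
  · obtain ⟨δ₁, h₁, δ₂, h₂, h12⟩ := hΔ.exists_pair
    exact ⟨π δ₁, ⟨δ₁, h₁, rfl⟩, π δ₂, ⟨δ₂, h₂, rfl⟩, by rw [hπ, h12]⟩

end Push

/-! ### The radical quotient of an alternating form -/

section Radical

variable {V : Type*} [AddCommGroup V] [Module ℚ V] (B : LinearMap.BilinForm ℚ V)

/-- **The radical quotient form.**  For an alternating form `B` the radical `ker B` is two-sided,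
so `B` descends to a bilinear form `B̄` on `V ⧸ ker B` with `B̄([x], [y]) = B(x, y)` (Mathlib's
`LinearMap.IsRefl.liftQ₂`).  Stated as an existence so that no definition is introduced; the
lemmas below take any such `B̄` as a parameter. [folklore] -/
theorem localTubeSpan_exists_quotForm (hB : B.IsAlt) :
    ∃ Bq : LinearMap.BilinForm ℚ (V ⧸ LinearMap.ker B),
      ∀ x y, Bq ((LinearMap.ker B).mkQ x) ((LinearMap.ker B).mkQ y) = B x y :=
  ⟨LinearMap.IsRefl.liftQ₂ B (LinearMap.ker B) hB.isRefl le_rfl, fun _ _ => rfl⟩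

/-- A radical quotient form of an alternating form is alternating. [folklore] -/
theorem localTubeSpan_quotForm_isAlt (hB : B.IsAlt)
    (Bq : LinearMap.BilinForm ℚ (V ⧸ LinearMap.ker B))
    (hBq : ∀ x y, Bq ((LinearMap.ker B).mkQ x) ((LinearMap.ker B).mkQ y) = B x y) :
    Bq.IsAlt := by
  intro q
  obtain ⟨x, rfl⟩ := Submodule.mkQ_surjective (LinearMap.ker B) q
  rw [hBq]
  exact hB x

/-- A radical quotient form of an alternating form is nondegenerate: a class pairing to zero with
every class (on either side) comes from `ker B`. [folklore] -/
theorem localTubeSpan_quotForm_nondegenerate (hB : B.IsAlt)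
    (Bq : LinearMap.BilinForm ℚ (V ⧸ LinearMap.ker B))
    (hBq : ∀ x y, Bq ((LinearMap.ker B).mkQ x) ((LinearMap.ker B).mkQ y) = B x y) :
    Bq.Nondegenerate := by
  refine ⟨fun q hq => ?_, fun q hq => ?_⟩
  · obtain ⟨x, rfl⟩ := Submodule.mkQ_surjective (LinearMap.ker B) q
    rw [Submodule.mkQ_apply, Submodule.Quotient.mk_eq_zero, LinearMap.mem_ker]
    ext y
    rw [LinearMap.zero_apply, ← hBq]
    exact hq _
  · obtain ⟨y, rfl⟩ := Submodule.mkQ_surjective (LinearMap.ker B) q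
    rw [Submodule.mkQ_apply, Submodule.Quotient.mk_eq_zero, LinearMap.mem_ker]
    ext x
    rw [LinearMap.zero_apply, ← hB.neg_eq, neg_eq_zero, ← hBq]
    exact hq _

end Radical

/-! ### Quotient transfer of Schnell's Lemma 11 -/

/-- **QUOTIENT TRANSFER** (stub `stub_quotientTransfer` of line `Sketch`, cycle 6).  Schnell's
Lemma 11 for NONDEGENERATE skew vanishing lattices (hypothesis `hL11nd`), applied to the radical
quotient `V ⧸ ker B` of a skew vanishing lattice `Δ` for an alternating, possibly degenerate form
`B` (again a skew vanishing lattice, for the nondegenerate alternating quotient form), yields: lifts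
`δ₁, …, δ_r ∈ Δ`, `r = dim V ⧸ ker B`, of a frame downstairs, linearly independent modulo the
radical, and finitely many `c ∈ Γ_Δ` (lifts of coset representatives of the finite-index frame
group downstairs) such that every `g ∈ Γ_Δ` agrees modulo the radical with some `c · h`, `h` in
the lifted frame group `Γ_{{δ₁, …, δ_r}}`. [cite: Schnell2010, §7 Lemma 11] -/
theorem localTubeSpan_quotientTransfer
    (hL11nd : ∀ (W : Type) [AddCommGroup W] [Module ℚ W] [FiniteDimensional ℚ W]
      (Bq : LinearMap.BilinForm ℚ W), Bq.IsAlt → Bq.Nondegenerate → ∀ Δq : Set W,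
      IsSkewVanishingLattice Bq Δq →
        ∃ (r : ℕ) (δ : Fin r → W), r = Module.finrank ℚ W ∧ (∀ i, δ i ∈ Δq) ∧
          LinearIndependent ℚ δ ∧
          ((transvectionGroup Bq (Set.range δ)).subgroupOf (transvectionGroup Bq Δq)).FiniteIndex)
    {V : Type} [AddCommGroup V] [Module ℚ V]
    [FiniteDimensional ℚ V] (B : LinearMap.BilinForm ℚ V) (hB : B.IsAlt) (Δ : Set V)
    (hΔ : IsSkewVanishingLattice B Δ) :
    ∃ (r : ℕ) (δ : Fin r → V), r = Module.finrank ℚ (V ⧸ LinearMap.ker B) ∧ (∀ i, δ i ∈ Δ) ∧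
      LinearIndependent ℚ ((LinearMap.ker B).mkQ ∘ δ) ∧
      ∃ C : Finset (V →ₗ[ℚ] V)ˣ, (∀ c ∈ C, c ∈ transvectionGroup B Δ) ∧
        ∀ g ∈ transvectionGroup B Δ, ∃ c ∈ C, ∃ h ∈ transvectionGroup B (Set.range δ),
          ∀ x : V, (g : V →ₗ[ℚ] V) x - ((c * h : (V →ₗ[ℚ] V)ˣ) : V →ₗ[ℚ] V) x ∈ LinearMap.ker B := by
  classical
  -- the nondegenerate alternating quotient form and the quotient lattice
  obtain ⟨Bq, hBq⟩ := localTubeSpan_exists_quotForm B hB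
  have hBqalt : Bq.IsAlt := localTubeSpan_quotForm_isAlt B hB Bq hBq
  have hBqnd : Bq.Nondegenerate := localTubeSpan_quotForm_nondegenerate B hB Bq hBq
  have hΔq : IsSkewVanishingLattice Bq ((LinearMap.ker B).mkQ '' Δ) :=
    localTubeSpan_isSkewVanishingLattice_push B Bq _ hB hBq (Submodule.mkQ_surjective _) hΔ
  -- Lemma 11 downstairs; lift the frame
  obtain ⟨r, δq, hr, hδqΔ, hliq, hfiq⟩ := hL11nd (V ⧸ LinearMap.ker B) Bq hBqalt hBqnd _ hΔq
  have hδqΔ' : ∀ i, ∃ d ∈ Δ, (LinearMap.ker B).mkQ d = δq i := fun i =>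
    (Set.mem_image _ _ _).1 (hδqΔ i)
  choose δ hδΔ hδq using hδqΔ'
  have hcomp : (LinearMap.ker B).mkQ ∘ δ = δq := funext hδq
  have hrange : Set.range δq = (LinearMap.ker B).mkQ '' Set.range δ := by
    rw [← hcomp, Set.range_comp]
  -- coset representatives of the frame group downstairs, and their lifts
  obtain ⟨S, hSΓ, hS⟩ := localTubeSpan_exists_finset_coset_reps _ _ hfiq
  have hlift : ∀ s : (V ⧸ LinearMap.ker B →ₗ[ℚ] V ⧸ LinearMap.ker B)ˣ,
      ∃ c ∈ transvectionGroup B Δ, s ∈ transvectionGroup Bq ((LinearMap.ker B).mkQ '' Δ) →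
        ∀ x, (s : V ⧸ LinearMap.ker B →ₗ[ℚ] V ⧸ LinearMap.ker B) ((LinearMap.ker B).mkQ x) =
          (LinearMap.ker B).mkQ ((c : V →ₗ[ℚ] V) x) := by
    intro s
    by_cases hs : s ∈ transvectionGroup Bq ((LinearMap.ker B).mkQ '' Δ)
    · obtain ⟨c, hc, hcs⟩ := localTubeSpan_transvectionGroup_lift B Bq _ hB hBq hs
      exact ⟨c, hc, fun _ => hcs⟩
    · exact ⟨1, one_mem _, fun h => absurd h hs⟩
  choose lift hliftΓ hlift using hlift
  have hsub : ∀ y z : V, (LinearMap.ker B).mkQ y = (LinearMap.ker B).mkQ z →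
      y - z ∈ LinearMap.ker B := fun y z hyz => by
    rwa [← LinearMap.sub_mem_ker_iff, Submodule.ker_mkQ] at hyz
  refine ⟨r, δ, hr, hδΔ, hcomp ▸ hliq, S.image lift, fun c hc => ?_, fun g hg => ?_⟩
  · obtain ⟨s, -, rfl⟩ := Finset.mem_image.1 hc
    exact hliftΓ s
  · -- push `g` down, factor through a representative, lift the frame part
    obtain ⟨w, hw, hwg⟩ := localTubeSpan_transvectionGroup_push B Bq _ hB hBq hg
    obtain ⟨s, hs, hsw⟩ := hS w hw
    rw [hrange] at hsw
    obtain ⟨h, hh, hhw⟩ := localTubeSpan_transvectionGroup_lift B Bq _ hB hBq hsw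
    refine ⟨lift s, Finset.mem_image_of_mem lift hs, h, hh, fun x => hsub _ _ ?_⟩
    rw [← hwg, Units.val_mul, Module.End.mul_apply, ← hlift s (hSΓ s hs), ← hhw,
      ← Module.End.mul_apply, ← Units.val_mul, mul_inv_cancel_left]

end Summit.HodgeConjecture.HodgeConjecture.Theorems

end
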